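import Literature.MathematicalPhysics.KineticTheory.LangevinChainSDE

/-!
# The generator on energy profiles: `L (∑ₓ ξₓ eₓ) = ∑_b (ξ_{b+1} - ξ_b) j_b + bath terms`

Helper file (`--supports stmt-AtomisticToContinuum-12699`, route `HonestZwanzig`, decl `ParityStatics`).

For an `OscillatorChain P` with differentiable potentials, `N` sites (free ends) and a weight
vector `ξ : Fin N → ℝ`, consider the ENERGY PROFILE observable
`E_ξ = ∑_k ξ_k (p_k²/2 + U(q_k)) + ∑_{l = k+1} ((ξ_k + ξ_l)/2) V(q_l - q_k)`, i.e. `∑ₓ ξₓ eₓ` for the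
symmetrically split site energies `eₓ = pₓ²/2 + U(qₓ) + ½V(q_{x+1} - qₓ) + ½V(qₓ - q_{x-1})` of the
route `HonestZwanzig` (bond energies shared evenly between the two ends; no bond beyond the ends).
We compute, pointwise and for every `N`:

* `partialP_energyProfile`: `∂_{p_i} E_ξ = ξ_i p_i`; `partialP_partialP_energyProfile`: `∂²_{p_i} E_ξ = ξ_i`;
* `partialQ_energyProfile`: the closed form of `∂_{q_i} E_ξ`;
* `liouville_energyProfile`: the Hamiltonian part `∑_i (p_i ∂_{q_i} - ∂_{q_i}H ∂_{p_i}) E_ξ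
   = ∑_{m = b+1} (ξ_m - ξ_b) · (-(p_b + p_m)/2 · V'(q_m - q_b))` — the local energy balance
   `ė_x = j_{x-1} - j_x` summed against `ξ` (discrete integration by parts, BLR's bond current
   `j_b = -½(p_b + p_{b+1}) V'(q_{b+1} - q_b)`);
* `generator_energyProfile`: adding the two Ornstein–Uhlenbeck bath terms,
  `L_{T_L,T_R} E_ξ = (above) + γ ∑_i ([i = 0] ξ_i (T_L - p_i²) + [i = N-1] ξ_i (T_R - p_i²))`;
* `splitSiteEnergy_eq_energyProfile`: the route's site energy `e_y` (written verbatim as in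
  `Summit.AtomisticToContinuum.FouriersLaw.Theses.HonestZwanzig.ParityStatics`) is `E_ξ` for the
  indicator weight `ξ = [· = y]`;
* `generator_splitSiteEnergy` / `pinnedChain_generator_splitSiteEnergy`:
  `L e_y = ∑_b ([y = b+1] j_b - [b = y] j_b) + [y = 0] γ (T_L - p_y²) + [y = N-1] γ (T_R - p_y²)`,
  in exactly the shape of the route decl `GeneratorSiteEnergy` (all real parameters, every `N`).

Template: `Literature/Barriers/AtomisticToContinuum/MazurBoundBallisticOpenChain.lean` (the case
`ξ_k = k`, energy first moment). Sources: Bonetto–Lebowitz–Rey-Bellet 2000 §5.2 eq. (23)–(25)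
(local energy balance defining the current); Kundu–Dhar–Narayan 2009 (continuity equation with
bath terms). Everything here is one-variable calculus of polynomials-in-disguise; nothing closes
an item.
-/

noncomputable section

namespace Summit.AtomisticToContinuum.FouriersLaw.Theorems.HonestZwanzig

open Literature.MathematicalPhysics.KineticTheory.HeatConduction
open Literature.MathematicalPhysics.KineticTheory.HeatConduction.OscillatorChain

variable (P : OscillatorChain) {N : ℕ}

/-! ### Coordinate derivatives of the energy profile `E_ξ` -/

/-- `∂_{p_i} E_ξ = ξ_i p_i` for the energy profile
`E_ξ = ∑_k ξ_k (p_k²/2 + U(q_k)) + ∑_{l=k+1} ((ξ_k+ξ_l)/2) V(q_l - q_k)` (no hypothesis on the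
potentials: the interaction part does not depend on the momenta). [folklore] -/
theorem partialP_energyProfile (ξ : Fin N → ℝ) (i : Fin N) (x : PhaseSpace N) :
    partialP i (fun z : PhaseSpace N => (∑ k : Fin N, ξ k * (z.2 k ^ 2 / 2 + P.U (z.1 k))) +
      ∑ k : Fin N, ∑ l : Fin N,
        if l.val = k.val + 1 then (ξ k + ξ l) / 2 * P.V (z.1 l - z.1 k) else 0) x = ξ i * x.2 i := by
  unfold partialP
  have h1 : HasDerivAt (fun t : ℝ => ∑ k : Fin N,
      ξ k * ((Function.update x.2 i t k) ^ 2 / 2 + P.U (x.1 k)))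
      (∑ k : Fin N, if k = i then ξ i * x.2 i else 0) (x.2 i) := by
    apply HasDerivAt.fun_sum
    intro k _
    by_cases hk : k = i
    · subst hk
      simp only [Function.update_self, if_true]
      have h' : HasDerivAt (fun t : ℝ => t ^ 2 / 2 + P.U (x.1 k)) (x.2 k) (x.2 k) := by
        have h := ((hasDerivAt_pow 2 (x.2 k)).div_const 2).add_const (P.U (x.1 k))
        have he : ((2 : ℕ) : ℝ) * x.2 k ^ (2 - 1) / 2 = x.2 k := by norm_num
        rwa [he] at h
      exact h'.const_mul _
    · simp only [Function.update_of_ne hk, hk, if_false]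
      exact hasDerivAt_const _ _
  have h2 : HasDerivAt (fun _ : ℝ => ∑ k : Fin N, ∑ l : Fin N,
      if l.val = k.val + 1 then (ξ k + ξ l) / 2 * P.V (x.1 l - x.1 k) else 0) 0 (x.2 i) :=
    hasDerivAt_const _ _
  have h := h1.add h2
  simp only [Finset.sum_ite_eq', Finset.mem_univ, if_true, add_zero] at h
  exact h.deriv

/-- `∂_{p_i} E_ξ` as a function: `ξ_i p_i`. [folklore] -/
theorem partialP_energyProfile_eq (ξ : Fin N → ℝ) (i : Fin N) :
    partialP i (fun z : PhaseSpace N => (∑ k : Fin N, ξ k * (z.2 k ^ 2 / 2 + P.U (z.1 k))) +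
      ∑ k : Fin N, ∑ l : Fin N,
        if l.val = k.val + 1 then (ξ k + ξ l) / 2 * P.V (z.1 l - z.1 k) else 0) =
      fun x => ξ i * x.2 i :=
  funext fun x => partialP_energyProfile P ξ i x

/-- `∂²_{p_i} E_ξ = ξ_i`. [folklore] -/
theorem partialP_partialP_energyProfile (ξ : Fin N → ℝ) (i : Fin N) (x : PhaseSpace N) :
    partialP i (partialP i (fun z : PhaseSpace N =>
      (∑ k : Fin N, ξ k * (z.2 k ^ 2 / 2 + P.U (z.1 k))) +
        ∑ k : Fin N, ∑ l : Fin N,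
          if l.val = k.val + 1 then (ξ k + ξ l) / 2 * P.V (z.1 l - z.1 k) else 0)) x = ξ i := by
  rw [partialP_energyProfile_eq P ξ i]
  unfold partialP
  simp only [Function.update_self]
  have h : HasDerivAt (fun t : ℝ => ξ i * t) (ξ i * 1) (x.2 i) := (hasDerivAt_id' (x.2 i)).const_mul _
  rw [mul_one] at h
  exact h.deriv

/-- Closed form of `∂_{q_i} E_ξ` for differentiable potentials:
`ξ_i U'(q_i) + ∑_{l = k+1} ((ξ_k+ξ_l)/2) V'(q_l - q_k) ([l = i] - [k = i])`. [folklore] -/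
theorem partialQ_energyProfile (hU : Differentiable ℝ P.U) (hV : Differentiable ℝ P.V)
    (ξ : Fin N → ℝ) (i : Fin N) (x : PhaseSpace N) :
    partialQ i (fun z : PhaseSpace N => (∑ k : Fin N, ξ k * (z.2 k ^ 2 / 2 + P.U (z.1 k))) +
      ∑ k : Fin N, ∑ l : Fin N,
        if l.val = k.val + 1 then (ξ k + ξ l) / 2 * P.V (z.1 l - z.1 k) else 0) x =
      ξ i * deriv P.U (x.1 i) + ∑ k : Fin N, ∑ l : Fin N,
        if l.val = k.val + 1 then
          (ξ k + ξ l) / 2 * deriv P.V (x.1 l - x.1 k) *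
            ((if l = i then 1 else 0) - (if k = i then 1 else 0)) else 0 := by
  unfold partialQ
  have h1 : HasDerivAt (fun t : ℝ => ∑ k : Fin N,
      ξ k * (x.2 k ^ 2 / 2 + P.U (Function.update x.1 i t k)))
      (∑ k : Fin N, if k = i then ξ i * deriv P.U (x.1 i) else 0) (x.1 i) := by
    apply HasDerivAt.fun_sum
    intro k _
    by_cases hk : k = i
    · subst hk
      simp only [Function.update_self, if_true]
      exact (((hU _).hasDerivAt).const_add _).const_mul _
    · simp only [Function.update_of_ne hk, hk, if_false]
      exact hasDerivAt_const _ _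
  have h2 : HasDerivAt (fun t : ℝ => ∑ k : Fin N, ∑ l : Fin N,
      if l.val = k.val + 1 then (ξ k + ξ l) / 2 * P.V (Function.update x.1 i t l -
        Function.update x.1 i t k) else 0)
      (∑ k : Fin N, ∑ l : Fin N, if l.val = k.val + 1 then
        (ξ k + ξ l) / 2 * deriv P.V (x.1 l - x.1 k) *
          ((if l = i then 1 else 0) - (if k = i then 1 else 0)) else 0) (x.1 i) := by
    refine HasDerivAt.fun_sum fun k _ => HasDerivAt.fun_sum fun l _ => ?_
    by_cases hlk : l.val = k.val + 1
    · simp only [hlk, if_true]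
      have ha : HasDerivAt (fun t => Function.update x.1 i t l - Function.update x.1 i t k)
          ((if l = i then 1 else 0) - (if k = i then 1 else 0)) (x.1 i) := by
        refine HasDerivAt.sub ?_ ?_
        · by_cases hl : l = i
          · subst hl; simp only [Function.update_self, if_true]; exact hasDerivAt_id _
          · simp only [Function.update_of_ne hl, hl, if_false]; exact hasDerivAt_const _ _
        · by_cases hk : k = i
          · subst hk; simp only [Function.update_self, if_true]; exact hasDerivAt_id _
          · simp only [Function.update_of_ne hk, hk, if_false]; exact hasDerivAt_const _ _
      have hcomp := ((hV _).hasDerivAt).comp (x.1 i) ha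
      have heval : Function.update x.1 i (x.1 i) l - Function.update x.1 i (x.1 i) k =
          x.1 l - x.1 k := by simp
      rw [heval] at hcomp
      have := hcomp.const_mul ((ξ k + ξ l) / 2)
      rw [← mul_assoc] at this
      exact this
    · simp only [hlk, if_false]
      exact hasDerivAt_const _ _
  have h := h1.add h2
  simp only [Finset.sum_ite_eq', Finset.mem_univ, if_true] at h
  exact h.deriv

/-! ### The Hamiltonian part: local energy balance summed against `ξ` -/

/-- **`{H, E_ξ} = ∑_b (ξ_{b+1} - ξ_b) j_b`**: the Hamiltonian (Liouville) part of the generator applied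
to the energy profile is the `ξ`-weighted divergence of BLR's bond currents
`j_b = -½(p_b + p_{b+1}) V'(q_{b+1} - q_b)`, written as a double sum over bonds `m = b + 1` (free
ends: no boundary currents). This is the local energy balance `ė_x = j_{x-1} - j_x` summed by
parts. [folklore] -/
theorem liouville_energyProfile (hU : Differentiable ℝ P.U) (hV : Differentiable ℝ P.V)
    (ξ : Fin N → ℝ) (x : PhaseSpace N) :
    ∑ i : Fin N, (x.2 i * partialQ i (fun z : PhaseSpace N =>
        (∑ k : Fin N, ξ k * (z.2 k ^ 2 / 2 + P.U (z.1 k))) +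
          ∑ k : Fin N, ∑ l : Fin N,
            if l.val = k.val + 1 then (ξ k + ξ l) / 2 * P.V (z.1 l - z.1 k) else 0) x -
      partialQ i (P.hamiltonian N) x * partialP i (fun z : PhaseSpace N =>
        (∑ k : Fin N, ξ k * (z.2 k ^ 2 / 2 + P.U (z.1 k))) +
          ∑ k : Fin N, ∑ l : Fin N,
            if l.val = k.val + 1 then (ξ k + ξ l) / 2 * P.V (z.1 l - z.1 k) else 0) x) =
      ∑ b : Fin N, ∑ m : Fin N, if m.val = b.val + 1 then
        (ξ m - ξ b) * (-((x.2 b + x.2 m) / 2 * deriv P.V (x.1 m - x.1 b))) else 0 := by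
  simp only [P.partialQ_hamiltonian_eq_dPotential hU hV, partialP_energyProfile P ξ,
    partialQ_energyProfile P hU hV ξ]
  -- pointwise form of the summand: the pinning terms cancel, the bond terms combine
  have key : ∀ i : Fin N,
      x.2 i * (ξ i * deriv P.U (x.1 i) + ∑ k : Fin N, ∑ l : Fin N, (if l.val = k.val + 1 then
          (ξ k + ξ l) / 2 * deriv P.V (x.1 l - x.1 k) *
            ((if l = i then 1 else 0) - (if k = i then 1 else 0)) else 0)) -
        P.dPotential N i x.1 * (ξ i * x.2 i) =
        ∑ k : Fin N, ∑ l : Fin N, if l.val = k.val + 1 then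
          x.2 i * deriv P.V (x.1 l - x.1 k) * (((ξ k + ξ l) / 2 - ξ i) *
            ((if l = i then 1 else 0) - (if k = i then 1 else 0))) else 0 := by
    intro i
    unfold OscillatorChain.dPotential
    set A := ∑ k : Fin N, ∑ l : Fin N, (if l.val = k.val + 1 then
      (ξ k + ξ l) / 2 * deriv P.V (x.1 l - x.1 k) *
        ((if l = i then 1 else 0) - (if k = i then 1 else 0)) else 0) with hA
    set B := ∑ k : Fin N, ∑ l : Fin N, (if l.val = k.val + 1 then
      deriv P.V (x.1 l - x.1 k) * ((if l = i then 1 else 0) - (if k = i then 1 else 0))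
        else 0) with hB
    have h1 : x.2 i * (ξ i * deriv P.U (x.1 i) + A) -
        (deriv P.U (x.1 i) + B) * (ξ i * x.2 i) = x.2 i * A - (ξ i * x.2 i) * B := by ring
    rw [h1, hA, hB, Finset.mul_sum, Finset.mul_sum, ← Finset.sum_sub_distrib]
    refine Finset.sum_congr rfl fun k _ => ?_
    rw [Finset.mul_sum, Finset.mul_sum, ← Finset.sum_sub_distrib]
    refine Finset.sum_congr rfl fun l _ => ?_
    split_ifs <;> ring
  simp only [key]
  -- exchange the sums: `∑_i ∑_k ∑_l = ∑_k ∑_l ∑_i`, then evaluate `∑_i`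
  rw [Finset.sum_comm]
  refine Finset.sum_congr rfl fun k _ => ?_
  rw [Finset.sum_comm]
  refine Finset.sum_congr rfl fun l _ => ?_
  rw [Finset.sum_ite_irrel, Finset.sum_const_zero]
  split_ifs with hlk
  · simp only [mul_sub, Finset.sum_sub_distrib, mul_ite, mul_one, mul_zero,
      Finset.sum_ite_eq, Finset.mem_univ, if_true]
    ring
  · rfl

/-! ### The full generator on `E_ξ` -/

/-- **The generator on an energy profile.** For differentiable potentials, every `N`, all
`T_L, T_R` and every weight `ξ`:
`L_{T_L,T_R} E_ξ = ∑_{m = b+1} (ξ_m - ξ_b)(-(p_b + p_m)/2 · V'(q_m - q_b))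
  + γ ∑_i ([i = 0] ξ_i (T_L - p_i²) + [i = N-1] ξ_i (T_R - p_i²))`
(weighted divergence of the bond currents plus the heat exchanged with the two baths).
[folklore] -/
theorem generator_energyProfile (hU : Differentiable ℝ P.U) (hV : Differentiable ℝ P.V)
    (ξ : Fin N → ℝ) (T_L T_R : ℝ) (x : PhaseSpace N) :
    P.generator N T_L T_R (fun z : PhaseSpace N =>
        (∑ k : Fin N, ξ k * (z.2 k ^ 2 / 2 + P.U (z.1 k))) +
          ∑ k : Fin N, ∑ l : Fin N,
            if l.val = k.val + 1 then (ξ k + ξ l) / 2 * P.V (z.1 l - z.1 k) else 0) x =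
      (∑ b : Fin N, ∑ m : Fin N, if m.val = b.val + 1 then
        (ξ m - ξ b) * (-((x.2 b + x.2 m) / 2 * deriv P.V (x.1 m - x.1 b))) else 0) +
      P.γ * ∑ i : Fin N, ((if i.val = 0 then ξ i * (T_L - x.2 i ^ 2) else 0) +
        (if i.val = N - 1 then ξ i * (T_R - x.2 i ^ 2) else 0)) := by
  unfold OscillatorChain.generator
  rw [liouville_energyProfile P hU hV ξ x]
  simp only [partialP_partialP_energyProfile P ξ, partialP_energyProfile P ξ]
  congr 1
  congr 1
  refine Finset.sum_congr rfl fun i _ => ?_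
  split_ifs <;> ring

/-! ### The split site energy `e_y` of the route is `E_{[· = y]}` -/

/-- The symmetrically split site energy `e_y = p_y²/2 + U(q_y) + ½V(q_{y+1} - q_y) + ½V(q_y - q_{y-1})`
of route `HonestZwanzig` (written verbatim as there) is the energy profile of the indicator
weight `ξ = [· = y]`. [folklore] -/
theorem splitSiteEnergy_eq_energyProfile (y : Fin N) :
    (fun z : PhaseSpace N => z.2 y ^ 2 / 2 + P.U (z.1 y) + ∑ j : Fin N,
        ((if j.val = y.val + 1 then P.V (z.1 j - z.1 y) / 2 else 0) +
          (if y.val = j.val + 1 then P.V (z.1 y - z.1 j) / 2 else 0))) =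
      fun z : PhaseSpace N =>
        (∑ k : Fin N, (if k = y then (1 : ℝ) else 0) * (z.2 k ^ 2 / 2 + P.U (z.1 k))) +
          ∑ k : Fin N, ∑ l : Fin N,
            if l.val = k.val + 1 then
              ((if k = y then (1 : ℝ) else 0) + (if l = y then (1 : ℝ) else 0)) / 2 *
                P.V (z.1 l - z.1 k) else 0 := by
  funext z
  simp only [ite_mul, one_mul, zero_mul, Finset.sum_ite_eq', Finset.mem_univ, if_true]
  rw [Finset.sum_add_distrib]
  -- split the bond sum into its `k = y` and `l = y` halves
  have hsplit : ∀ k l : Fin N, (if l.val = k.val + 1 then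
      ((if k = y then (1 : ℝ) else 0) + (if l = y then (1 : ℝ) else 0)) / 2 *
        P.V (z.1 l - z.1 k) else 0) =
      (if k = y then (if l.val = k.val + 1 then P.V (z.1 l - z.1 k) / 2 else 0) else 0) +
        (if l = y then (if l.val = k.val + 1 then P.V (z.1 l - z.1 k) / 2 else 0) else 0) := by
    intro k l
    split_ifs <;> ring
  simp only [hsplit, Finset.sum_add_distrib, Finset.sum_ite_irrel, Finset.sum_const_zero,
    Finset.sum_ite_eq', Finset.mem_univ, if_true]

/-- **The generator on the split site energy** (the route's `GeneratorSiteEnergy`, for every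
`OscillatorChain` with differentiable potentials, every `N`, all `T_L, T_R`):
`L e_y = ∑_b ([y = b+1] j_b - [b = y] j_b) + [y = 0] γ (T_L - p_y²) + [y = N-1] γ (T_R - p_y²)` —
energy balance at site `y` (currents in and out, plus the bath heat at the ends).
[Bonetto–Lebowitz–Rey-Bellet 2000, §5.2 eq. (23)–(25)] [folklore] -/
theorem generator_splitSiteEnergy (hU : Differentiable ℝ P.U) (hV : Differentiable ℝ P.V)
    (y : Fin N) (T_L T_R : ℝ) (x : PhaseSpace N) :
    P.generator N T_L T_R (fun z : PhaseSpace N => z.2 y ^ 2 / 2 + P.U (z.1 y) + ∑ j : Fin N,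
        ((if j.val = y.val + 1 then P.V (z.1 j - z.1 y) / 2 else 0) +
          (if y.val = j.val + 1 then P.V (z.1 y - z.1 j) / 2 else 0))) x =
      (∑ b : Fin N, ((if y.val = b.val + 1 then P.bondCurrent N b x else 0) -
        (if b = y then P.bondCurrent N b x else 0))) +
      (if y.val = 0 then P.γ * (T_L - x.2 y ^ 2) else 0) +
      (if y.val = N - 1 then P.γ * (T_R - x.2 y ^ 2) else 0) := by
  rw [splitSiteEnergy_eq_energyProfile P y, generator_energyProfile P hU hV]
  -- the bath part collapses to the site `y`
  have hbath : ∑ i : Fin N, ((if i.val = 0 then (if i = y then (1 : ℝ) else 0) * (T_L - x.2 i ^ 2)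
      else 0) + (if i.val = N - 1 then (if i = y then (1 : ℝ) else 0) * (T_R - x.2 i ^ 2) else 0)) =
      (if y.val = 0 then T_L - x.2 y ^ 2 else 0) + (if y.val = N - 1 then T_R - x.2 y ^ 2 else 0) := by
    rw [Finset.sum_eq_single y]
    · simp
    · intro i _ hi
      simp [hi]
    · intro h
      exact absurd (Finset.mem_univ y) h
  rw [hbath, add_assoc]
  congr 1
  · -- the current part, bond by bond
    refine Finset.sum_congr rfl fun b _ => ?_
    unfold OscillatorChain.bondCurrent
    by_cases hyb : y.val = b.val + 1
    · have hby : b ≠ y := by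
        intro h; rw [h] at hyb; omega
      rw [if_pos hyb]
      simp only [hby, if_false, sub_zero]
      refine Finset.sum_congr rfl fun m _ => ?_
      by_cases hm : m.val = b.val + 1
      · have hmy : m = y := Fin.ext (by omega)
        simp [hmy]
      · simp [hm]
    · rw [if_neg hyb, zero_sub]
      by_cases hby : b = y
      · subst hby
        simp only [if_true]
        rw [← Finset.sum_neg_distrib]
        refine Finset.sum_congr rfl fun m _ => ?_
        by_cases hm : m.val = b.val + 1
        · have hmy : m ≠ b := by
            intro h; rw [h] at hm; omega
          simp [hm, hmy]
        · simp [hm]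
      · simp only [hby, if_false, neg_zero, sub_zero]
        refine Finset.sum_eq_zero fun m _ => ?_
        by_cases hm : m.val = b.val + 1
        · have hmy : m ≠ y := by
            intro h; rw [h] at hm; exact hyb hm
          simp [hm, hmy]
        · simp [hm]
  · split_ifs <;> ring

/-- **`GeneratorSiteEnergy` for the pinned anharmonic chain** `pinnedChain ω₂ lam β γ` (ALL real
parameters, every `N`, all `T_L, T_R`; the route decl asks `N ≥ 2`, which is not needed):
`L e_y = ∑_b ([y = b+1] j_b - [b = y] j_b) + [y = 0] γ (T_L - p_y²) + [y = N-1] γ (T_R - p_y²)`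
pointwise, with `e_y` and the right-hand side spelled exactly as in
`Summit.AtomisticToContinuum.FouriersLaw.Theses.HonestZwanzig.GeneratorSiteEnergy`. [folklore] -/
theorem pinnedChain_generator_splitSiteEnergy (ω₂ lam β γ : ℝ) (N : ℕ) (T_L T_R : ℝ) (y : Fin N)
    (x : PhaseSpace N) :
    (pinnedChain ω₂ lam β γ).generator N T_L T_R (fun z : PhaseSpace N => z.2 y ^ 2 / 2 +
        (pinnedChain ω₂ lam β γ).U (z.1 y) + ∑ j : Fin N,
          ((if j.val = y.val + 1 then (pinnedChain ω₂ lam β γ).V (z.1 j - z.1 y) / 2 else 0) +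
            (if y.val = j.val + 1 then (pinnedChain ω₂ lam β γ).V (z.1 y - z.1 j) / 2 else 0))) x =
      (∑ b : Fin N, ((if y.val = b.val + 1 then (pinnedChain ω₂ lam β γ).bondCurrent N b x else 0) -
        (if b = y then (pinnedChain ω₂ lam β γ).bondCurrent N b x else 0))) +
      (if y.val = 0 then (pinnedChain ω₂ lam β γ).γ * (T_L - x.2 y ^ 2) else 0) +
      (if y.val = N - 1 then (pinnedChain ω₂ lam β γ).γ * (T_R - x.2 y ^ 2) else 0) :=
  generator_splitSiteEnergy _
    ((pinnedChain_contDiff_U ω₂ lam β γ (n := 1)).differentiable one_ne_zero)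
    ((pinnedChain_contDiff_V ω₂ lam β γ (n := 1)).differentiable one_ne_zero) y T_L T_R x

end Summit.AtomisticToContinuum.FouriersLaw.Theorems.HonestZwanzig

end
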